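import Mathlib.AlgebraicGeometry.AffineTransitionLimit
import HarnessLib

/-!
# Limits of schemes: sections over the preimage of a quasi-compact open come from a stage,
# and finitely many such data descend simultaneously

Topic: `Literature/AlgebraicGeometry/Limits` (The Stacks Project, Tag 01YT "Limits of schemes";
EGA IV₃ §8.2–8.5; Görtz–Wedhorn I, §10.13). Let `c.pt = lim_i D i` be the limit of a cofiltered
diagram of schemes with affine transition maps, with projections `π_i`. Mathlib proves that
GLOBAL sections of the limit come from some stage when the stages are quasi-compact and
quasi-separated (`exists_appTop_π_eq_of_isLimit`) and that a section of a stage over a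
quasi-compact open which dies on the limit dies at some stage (`exists_app_map_eq_zero_of_isLimit`,
`exists_app_map_eq_map_of_isLimit`). This file records the forms needed to descend FINITE
COLLECTIONS of local data (transition matrices of a vector bundle and their cocycle identities,
`Limits/FiniteLocallyFreeDescent`):

* `exists_hom_forall_of_finite` — in a cofiltered category, finitely many properties of arrows
  `j ⟶ i`, each stable under precomposition and each satisfied by some arrow, are satisfied by ONE
  common arrow (`IsCofiltered.cospan`);
* `exists_appLE_π_eq_of_isLimit` — **a section of the limit over `π_i⁻¹ U`, `U ⊆ D i` a
  quasi-compact open of a quasi-separated stage, is the pull-back of a section of some stage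
  `D j` over `(D j ⟶ D i)⁻¹ U`** (Mathlib's global statement applied to the opens diagram
  `opensDiagram D i U`, whose limit is `π_i⁻¹ U`, `isLimitOpensCone`);
* `exists_appLE_π_eq_of_finite`, `exists_app_map_eq_map_of_finite` — the simultaneous versions
  for finite families of sections / of equalities.

Everything is proved; no named facts.

## Edition 2 (2026-08-29)

Docstring-only re-filing (watcher-trigger edition, cell `hodgecm-mathlib`, director ruling s149):
the declarations below are byte-identical to edition 1 (2026-08-21); the file is re-submitted so
that the hub build lane produces this module's `.olean`, which the downstream importers
`Limits/FiniteLocallyFreeDescentStages` (this topic) and the 2026-08-29 consumer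
`Limits/FiniteLocallyFreeIsoDescent` (M13 node N0 (0d), G3) need.

## References

* The Stacks Project, Chapter 32 (Limits of schemes, Tag 01YT): Lemma 32.4.7 (Tag 01Z0),
  Lemma 32.4.11 (Tag 01Z4), Lemma 32.10.3 (Tag 0B8W); Definition 4.20.1 (Tag 04AZ).
  [StacksProject]
* A. Grothendieck, J. Dieudonné, EGA IV₃ (1966), Thm. 8.5.2, Cor. 8.5.8.
* U. Görtz, T. Wedhorn, *Algebraic Geometry I*, 2nd ed. (2020), §10.13, Thm. 10.57.
  [GortzWedhorn2020]
-/

universe u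

open CategoryTheory CategoryTheory.Limits AlgebraicGeometry TopologicalSpace Opposite

namespace Literature.AlgebraicGeometry.Limits

set_option backward.isDefEq.respectTransparency false

/-! ### Cofiltered combinatorics: one arrow for finitely many stable properties -/

/-- **One common refinement for finitely many eventually-true properties.** In a cofiltered
category, let `P a` (`a` ranging over a finite type) be properties of arrows `j ⟶ i` into a fixed
object, each stable under precomposition (`P a f → P a (g ≫ f)`) and each satisfied by some arrow.
Then a single arrow satisfies all of them (induction, using `IsCofiltered.cospan` to dominate two
arrows by arrows with equal composites) — an immediate consequence of the definition of a
cofiltered category. [cite: StacksProject, Tag 04AZ (Definition 4.20.1)] -/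
theorem exists_hom_forall_of_finite {I : Type*} [Category I] [IsCofiltered I] {α : Type*}
    [Finite α] {i : I} (P : α → ∀ ⦃j : I⦄, (j ⟶ i) → Prop)
    (hP : ∀ (a : α) ⦃j : I⦄ (f : j ⟶ i) ⦃k : I⦄ (g : k ⟶ j), P a f → P a (g ≫ f))
    (h : ∀ a, ∃ (j : I) (f : j ⟶ i), P a f) :
    ∃ (j : I) (f : j ⟶ i), ∀ a, P a f := by
  classical
  suffices H : ∀ s : Finset α, ∃ (j : I) (f : j ⟶ i), ∀ a ∈ s, P a f by
    cases nonempty_fintype α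
    obtain ⟨j, f, hj⟩ := H Finset.univ
    exact ⟨j, f, fun a => hj a (Finset.mem_univ a)⟩
  intro s
  induction s using Finset.induction_on with
  | empty => exact ⟨i, 𝟙 i, fun a ha => absurd ha (Finset.notMem_empty a)⟩
  | insert a s _ ih =>
    obtain ⟨j, f, hj⟩ := ih
    obtain ⟨j', f', hj'⟩ := h a
    obtain ⟨k, g, g', hk⟩ := IsCofiltered.cospan f f'
    refine ⟨k, g ≫ f, fun b hb => ?_⟩
    rcases Finset.mem_insert.mp hb with rfl | hb
    · rw [hk]; exact hP _ f' g' hj'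
    · exact hP b f g (hj b hb)

/-! ### Sections of the limit over the preimage of a quasi-compact open -/

section Sections

variable {I : Type u} [Category.{u} I] [IsCofiltered I] (D : I ⥤ Scheme.{u})
  (c : Cone D) (hc : IsLimit c) [∀ {i j : I} (f : i ⟶ j), IsAffineHom (D.map f)]

/-- Changing the name of the morphism in `Scheme.Hom.appLE` along an equality of morphisms.
[folklore] -/
private lemma appLE_congr_hom {X Y : Scheme.{u}} {f g : X ⟶ Y} (h : f = g) (U : Y.Opens) (V : X.Opens)
    (e : V ≤ f ⁻¹ᵁ U) : f.appLE U V e = g.appLE U V (h ▸ e) := by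
  subst h; rfl

include hc in
/-- **Sections of the limit over `π_i⁻¹ U` come from a stage** (`U` a quasi-compact open of the
quasi-separated stage `D i`): there are `f : j ⟶ i` and `t ∈ Γ(D j, (D f)⁻¹ U)` with
`π_j^♯ t = s`. This is `Γ(lim_j (D f)⁻¹U, 𝒪) = colim_j Γ((D f)⁻¹ U, 𝒪)` (Stacks 01Z0 / Mathlib
`exists_appTop_π_eq_of_isLimit`) for the opens diagram over `U`, whose limit is `π_i⁻¹ U`
(Mathlib `isLimitOpensCone`). [cite: StacksProject, Tag 01Z0 (Lemma 32.4.7)] -/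
theorem exists_appLE_π_eq_of_isLimit [∀ i, QuasiSeparatedSpace (D.obj i)] {i : I}
    {U : (D.obj i).Opens} (hU : IsCompact (U : Set (D.obj i))) {U' : c.pt.Opens}
    (hU' : c.π.app i ⁻¹ᵁ U = U') (s : Γ(c.pt, U')) :
    ∃ (j : I) (f : j ⟶ i) (t : Γ(D.obj j, D.map f ⁻¹ᵁ U)),
      (c.π.app j).appLE (D.map f ⁻¹ᵁ U) U'
        (by rw [← hU', ← Scheme.Hom.comp_preimage, c.w]) t = s := by
  subst hU'
  haveI : ∀ j : Over i, CompactSpace ((opensDiagram D i U).obj j) := fun j =>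
    isCompact_iff_compactSpace.mp ((D.map j.hom).isCompact_preimage hU)
  haveI : ∀ j : Over i, QuasiSeparatedSpace ((opensDiagram D i U).obj j) := fun j =>
    QuasiSeparatedSpace.of_isOpenEmbedding (D.map j.hom ⁻¹ᵁ U).ι.isOpenEmbedding
  obtain ⟨j, t, ht⟩ := exists_appTop_π_eq_of_isLimit (opensDiagram D i U) (opensCone D c i U)
    (isLimitOpensCone D c hc i U) ((c.π.app i ⁻¹ᵁ U).topIso.inv s)
  refine ⟨j.left, j.hom, (D.map j.hom ⁻¹ᵁ U).topIso.hom t, ?_⟩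
  have h1 : s = (c.π.app i ⁻¹ᵁ U).topIso.hom (((opensCone D c i U).π.app j).appTop t) := by
    rw [← ht]
    exact ((c.π.app i ⁻¹ᵁ U).topIso.inv_hom_id_apply s).symm
  rw [h1, opensCone_π_app, Scheme.Hom.appTop, Scheme.Hom.resLE_app_top]
  change _ = ((c.π.app i ⁻¹ᵁ U).topIso.inv ≫ (c.π.app i ⁻¹ᵁ U).topIso.hom)
    ((c.π.app j.left).appLE _ _ _ ((D.map j.hom ⁻¹ᵁ U).topIso.hom t))
  rw [Iso.inv_hom_id]
  rfl

include hc in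
/-- **Finitely many sections of the limit descend to one stage**: for a finite family of
quasi-compact opens `U a ⊆ D i` and sections `s a ∈ Γ(c.pt, π_i⁻¹ U a)` there are `f : j ⟶ i`
and `t a ∈ Γ(D j, (D f)⁻¹ U a)` with `π_j^♯ (t a) = s a` for all `a`.
[cite: StacksProject, Tag 01Z0 (Lemma 32.4.7)] -/
theorem exists_appLE_π_eq_of_finite [∀ i, QuasiSeparatedSpace (D.obj i)] {i : I} {α : Type*}
    [Finite α] (U : α → (D.obj i).Opens) (hU : ∀ a, IsCompact (U a : Set (D.obj i)))
    (U' : α → c.pt.Opens) (hU' : ∀ a, c.π.app i ⁻¹ᵁ U a = U' a) (s : ∀ a, Γ(c.pt, U' a)) :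
    ∃ (j : I) (f : j ⟶ i) (t : ∀ a, Γ(D.obj j, D.map f ⁻¹ᵁ U a)),
      ∀ a, (c.π.app j).appLE (D.map f ⁻¹ᵁ U a) (U' a)
        (by rw [← hU', ← Scheme.Hom.comp_preimage, c.w]) (t a) = s a := by
  -- the property "`s a` comes from stage `(j, f)`" is stable under refinement
  let P : α → ∀ ⦃j : I⦄, (j ⟶ i) → Prop := fun a j f =>
    ∃ t : Γ(D.obj j, D.map f ⁻¹ᵁ U a), (c.π.app j).appLE (D.map f ⁻¹ᵁ U a) (U' a)
      (by rw [← hU', ← Scheme.Hom.comp_preimage, c.w]) t = s a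
  have hP : ∀ (a : α) ⦃j : I⦄ (f : j ⟶ i) ⦃k : I⦄ (g : k ⟶ j), P a f → P a (g ≫ f) := by
    rintro a j f k g ⟨t, ht⟩
    refine ⟨(D.map g).appLE (D.map f ⁻¹ᵁ U a) (D.map (g ≫ f) ⁻¹ᵁ U a)
      (by rw [D.map_comp, Scheme.Hom.comp_preimage]) t, ?_⟩
    rw [← ht, ← CategoryTheory.comp_apply, Scheme.Hom.appLE_comp_appLE,
      appLE_congr_hom (c.w g)]
    rfl
  obtain ⟨j, f, hj⟩ := exists_hom_forall_of_finite P hP fun a =>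
    exists_appLE_π_eq_of_isLimit D c hc (hU a) (hU' a) (s a)
  choose t ht using hj
  exact ⟨j, f, t, ht⟩

include hc in
/-- **Finitely many equalities holding on the limit hold at one stage**: for a finite family of
quasi-compact opens `U a ⊆ D i` and sections `s a, s' a ∈ Γ(D i, U a)` with
`π_i^♯ (s a) = π_i^♯ (s' a)`, there is `f : j ⟶ i` with `(D f)^♯ (s a) = (D f)^♯ (s' a)` for all
`a` (Mathlib `exists_app_map_eq_map_of_isLimit`, one `a` at a time, combined by
`exists_hom_forall_of_finite`). [cite: StacksProject, Tag 01Z0 (Lemma 32.4.7)] -/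
theorem exists_app_map_eq_map_of_finite {i : I} {α : Type*} [Finite α]
    (U : α → (D.obj i).Opens) (hU : ∀ a, IsCompact (U a : Set (D.obj i)))
    (s s' : ∀ a, Γ(D.obj i, U a)) (hs : ∀ a, (c.π.app i).app (U a) (s a) = (c.π.app i).app (U a) (s' a)) :
    ∃ (j : I) (f : j ⟶ i), ∀ a, (D.map f).app (U a) (s a) = (D.map f).app (U a) (s' a) := by
  let P : α → ∀ ⦃j : I⦄, (j ⟶ i) → Prop := fun a j f =>
    (D.map f).app (U a) (s a) = (D.map f).app (U a) (s' a)
  have hP : ∀ (a : α) ⦃j : I⦄ (f : j ⟶ i) ⦃k : I⦄ (g : k ⟶ j), P a f → P a (g ≫ f) := by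
    intro a j f k g hf
    change (D.map (g ≫ f)).app (U a) (s a) = (D.map (g ≫ f)).app (U a) (s' a)
    rw [Scheme.Hom.congr_app (D.map_comp g f) (U a), Scheme.Hom.comp_app]
    change (D.obj k).presheaf.map _ ((D.map g).app _ ((D.map f).app (U a) (s a))) =
      (D.obj k).presheaf.map _ ((D.map g).app _ ((D.map f).app (U a) (s' a)))
    rw [hf]
  exact exists_hom_forall_of_finite P hP fun a =>
    exists_app_map_eq_map_of_isLimit D c hc (hU a) (s a) (s' a) (hs a)

end Sections

end Literature.AlgebraicGeometry.Limits
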